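import Summits.CriticalPhenomena.Ising3DConformalLimit.Theorems.IsingEuclidUpgradeR4NonGaussianCutDefs
import HarnessLib

/-!
# Crux `IsingEuclidUpgradeR4NonGaussian` (stmt-CriticalPhenomena-0636), line `partner-backbone-cut`:
# Stub 1 — backbone-cut decomposition + contact inclusion

Registered stub `stub_backboneCutDecomposition` of the checked skeleton
`Cruxes/IsingEuclidUpgradeR4NonGaussian/Lines/partner-backbone-cut.lean`: for every finite graph `G`,
uniform coupling `β ≥ 0`, injective ranking `rk` and vertices `x y z t`,
`Σ_{δ ∈ finalStates(z→t)} patSum(δ) · (Σ W_δ 1[N_δ ≥ 1]) ≤ P^{xy,zt}[x ↔ z] · Z[xy] · Z[zt]`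
(`connMass`).

Mechanism (Aizenman 1982 §9, as organised in the tree files `CurrentExplorationWeights` /
`BackboneChainRule`): partition the `{z,t}`-currents `n₂` by the final state `δ = explore rk n₂ {t} z`
of Aizenman's walk (it ends at `t` because `∂n₂ = {z} Δ {t}`, `Current.explore_done_of_sources_eq`);
on the cylinder of `δ` split `n₂ = p + m` along `D = δ.used` (`Current.tsum_eq_tsum_prod_onEdges`):
the pattern parts `p` sum to `patSum δ` and the remainder `m` is an exact SOURCELESS current
supported on the cut graph `cutGraph G D` — this is the FUNCTIONAL chain rule
`tsum_sources_inCyl_mul_eq` below (the tree's `tsum_sources_inCyl_eq` with a functional of the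
off-part riding along); finally the inclusion `{N_δ(m + n₁) ≥ 1} ⊆ {x ↔ z in n₁ + n₂}`: a contact
`u ∈ δ.vis` reached from `x` through cut-graph bonds of `m + n₁ ≤ n₁ + n₂` hangs on `z` through the
bonds of `n₂` (`Current.vis_subset_tch_explore`, `Current.tch_explore_subset_cluster`).
Dimension-free; no named fact.

References: M. Aizenman, Comm. Math. Phys. 86 (1982) §9, Prop. 9.2, Lemma 9.2;
M. Aizenman, H. Duminil-Copin, Ann. Math. 194 (2021) = arXiv:1912.07973 §3 (3.11), §4.2.
-/

noncomputable section

namespace Summit.CriticalPhenomena.Ising3DConformalLimit.Cruxes.IsingEuclidUpgradeR4NonGaussian.PartnerBackboneCut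

open Literature.Probability Literature.Probability.LatticeModels Literature.Probability.Percolation
open MeasureTheory Filter Finset Current
open scoped Topology symmDiff ENNReal

variable {V : Type*} [Fintype V] [DecidableEq V] {G : SimpleGraph V} [DecidableRel G.Adj]

/-! ### The cut graph and supports -/

/-- An edge of `G` is an edge of the cut graph `H_D` iff it is not in `D`. [folklore] -/
theorem coe_mem_cutGraph_edgeFinset_iff {D : Finset G.edgeFinset} (e : G.edgeFinset) :
    (e : Sym2 V) ∈ (cutGraph G D).edgeFinset ↔ e ∉ D := by
  rcases e with ⟨e, he⟩
  induction e using Sym2.ind with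
  | h a b =>
    rw [SimpleGraph.mem_edgeFinset, SimpleGraph.mem_edgeSet, cutGraph_adj]
    have hadj : G.Adj a b := by
      rw [SimpleGraph.mem_edgeFinset] at he; exact he
    constructor
    · rintro ⟨-, h⟩ hmem
      exact h (Finset.mem_image.2 ⟨⟨s(a, b), he⟩, hmem, rfl⟩)
    · intro h
      refine ⟨hadj, fun hmem => ?_⟩
      obtain ⟨e', he', hee'⟩ := Finset.mem_image.1 hmem
      have : e' = ⟨s(a, b), he⟩ := Subtype.ext hee'
      exact h (this ▸ he')

/-- A current is supported on the cut graph `H_D` iff it vanishes on `D`. [folklore] -/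
theorem isSupp_cutGraph_iff {D : Finset G.edgeFinset} (m : Current G) :
    IsSupp (cutGraph G D) m ↔ ∀ e, e ∈ D → m e = 0 := by
  unfold IsSupp
  constructor
  · intro h e he
    exact h e (fun hmem => (coe_mem_cutGraph_edgeFinset_iff e).1 hmem he)
  · intro h e he
    exact h e (by
      by_contra hc
      exact he ((coe_mem_cutGraph_edgeFinset_iff e).2 hc))

/-! ### The functional chain rule on a cylinder -/

section ChainRule

variable {K : G.edgeFinset → ℝ} {rk : G.edgeFinset → ℕ}

/-- **The functional chain rule for the cylinder of a walk** (the tree's `tsum_sources_inCyl_eq` with a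
functional of the off-part): for the walk `δ` of `n₀` from `a` and any `H : Current G → ℝ≥0∞`,
`Σ_{∂n = A, n ∈ Cyl(δ)} w_K(n) · H(n|_{used(δ)ᶜ}) = patSum K δ · Σ_{m ≡ 0 on used(δ), ∂m = A Δ {a} Δ {δ.pos}} w_K(m) H(m)`:
conditionally on the walk, the remainder of the current is a current of the graph with the used bonds
deleted, with the same couplings (Aizenman 1982, Prop. 9.2 / Lemma 9.2). [cite: AizenmanCMP1982, Prop. 9.2 and Lemma 9.2] -/
theorem tsum_sources_inCyl_mul_eq (hK : ∀ e, 0 ≤ K e) (hrk : Function.Injective rk) {n₀ : Current G}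
    {Y : Finset V} {a : V} {δ : XState G} (hδ : δ = explore rk n₀ Y a) (A : Finset V)
    (H : Current G → ℝ≥0∞) :
    ∑' n : Current G, (if n.sources = A ∧ InCyl δ n then n.eweight K else 0) * H (onEdges δ.usedᶜ n) =
      patSum K δ * ∑' m : Current G,
        (if (∀ e, e ∈ δ.used → m e = 0) ∧ m.sources = A ∆ ({a} ∆ {δ.pos}) then m.eweight K else 0) *
          H m := by
  have hsrc : ∀ m : Current G, (∀ e, e ∉ δ.used → m e = 0) → InCyl δ m → m.sources = {a} ∆ {δ.pos} := by
    intro m h0 hc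
    subst hδ
    refine sources_eq_of_cls_eq hrk a h0 fun e he => ?_
    rw [hc e he, pat_explore a he]
  rw [tsum_eq_tsum_prod_onEdges δ.used, patSum, ← ENNReal.tsum_mul_right]
  simp_rw [← ENNReal.tsum_mul_left]
  rw [← ENNReal.tsum_prod]
  refine tsum_congr fun p => ?_
  by_cases hm : (∀ e, e ∉ δ.used → p.1 e = 0)
  · by_cases hr : (∀ e, e ∈ δ.used → p.2 e = 0)
    · rw [if_pos ⟨hm, hr⟩, onEdges_compl_add_eq_right hm hr]
      have hw : (p.1 + p.2).eweight K = p.1.eweight K * p.2.eweight K :=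
        eweight_add_of_forall_or hK fun e => by
          by_cases he : e ∈ δ.used
          · exact Or.inr (hr e he)
          · exact Or.inl (hm e he)
      by_cases hc : InCyl δ p.1
      · have hc' : InCyl δ (p.1 + p.2) := (inCyl_add_iff_of_forall hr).mpr hc
        have hs1 : (p.1 + p.2).sources = ({a} ∆ {δ.pos}) ∆ p.2.sources := by
          rw [Current.sources_add, hsrc p.1 hm hc]
        by_cases hs : p.2.sources = A ∆ ({a} ∆ {δ.pos})
        · have hsA : (p.1 + p.2).sources = A := by
            rw [hs1, hs, symmDiff_comm A, symmDiff_symmDiff_cancel_left]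
          rw [if_pos ⟨hsA, hc'⟩, if_pos ⟨hm, hc⟩, if_pos ⟨hr, hs⟩, hw, mul_assoc]
        · have hsA : (p.1 + p.2).sources ≠ A := fun h => hs (by
            rw [hs1, symmDiff_eq_iff_eq, symmDiff_comm] at h; exact h)
          rw [if_neg (fun h => hsA h.1), if_pos ⟨hm, hc⟩,
            if_neg (show ¬ ((∀ e, e ∈ δ.used → p.2 e = 0) ∧ p.2.sources = A ∆ ({a} ∆ {δ.pos})) from
              fun h => hs h.2)]
          simp
      · have hc' : ¬ InCyl δ (p.1 + p.2) := fun h => hc ((inCyl_add_iff_of_forall hr).mp h)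
        rw [if_neg (fun h => hc' h.2), if_neg (fun h => hc h.2), zero_mul, zero_mul]
    · rw [if_neg (fun h => hr h.2),
        if_neg (show ¬ ((∀ e, e ∈ δ.used → p.2 e = 0) ∧ p.2.sources = A ∆ ({a} ∆ {δ.pos})) from
          fun h => hr h.1), zero_mul, mul_zero]
  · rw [if_neg (fun h => hm h.1), if_neg (fun h => hm h.1), zero_mul]

/-- The functional chain rule read on `finalStates`: for `δ ∈ finalStates rk Y a u`,
`Σ_{∂n = A, n ∈ Cyl(δ)} w(n) H(n|_{used(δ)ᶜ}) = patSum δ · Σ_{m ⊆ E(H_{used(δ)}), ∂m = A Δ {a} Δ {u}} w(m) H(m)`,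
the remainder read as a current SUPPORTED ON THE CUT GRAPH. [cite: AizenmanCMP1982, Prop. 9.2 and Lemma 9.2] -/
theorem tsum_sources_inCyl_mul_eq_of_mem_finalStates (hK : ∀ e, 0 ≤ K e) (hrk : Function.Injective rk)
    {Y : Finset V} {a u : V} {δ : XState G} (hδ : δ ∈ finalStates rk Y a u) (A : Finset V)
    (H : Current G → ℝ≥0∞) :
    ∑' n : Current G, (if n.sources = A ∧ InCyl δ n then n.eweight K else 0) * H (onEdges δ.usedᶜ n) =
      patSum K δ * ∑' m : Current G,
        (if IsSupp (cutGraph G δ.used) m ∧ m.sources = A ∆ ({a} ∆ {u}) then m.eweight K else 0) * H m := by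
  obtain ⟨hpos, n₀, hδ'⟩ := mem_finalStates_iff.1 hδ
  rw [tsum_sources_inCyl_mul_eq hK hrk hδ' A H, hpos]
  congr 1
  refine tsum_congr fun m => ?_
  simp only [isSupp_cutGraph_iff]

end ChainRule


/-! ### The contact inclusion -/

/-- **A contact forces the connection.** If `δ` is the walk of `n₂` from `z` with target `{t}` and a
site `u ∈ δ.vis` is joined to `x` through cut-graph bonds carrying positive current `m + n₁` with
`m ≤ n₂`, then `x ↔ z` in the trace of `n₁ + n₂` (visited sites hang on `z` through the bonds of `n₂`:
`Current.vis_subset_tch_explore`, `Current.tch_explore_subset_cluster`). [cite: AizenmanCMP1982, §9] -/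
theorem mem_tracedConn_of_contactCount_ne_zero {rk : G.edgeFinset → ℕ} {z t x : V} {δ : XState G}
    {n₂ : Current G} (hδ : explore rk n₂ {t} z = δ) {n₁ m : Current G} (hm : m ≤ n₂)
    (h : contactCount G δ.used δ.vis x (m + n₁) ≠ 0) : (n₁, n₂) ∈ tracedConn G x z := by
  obtain ⟨u, hu, hne⟩ := Finset.exists_ne_zero_of_sum_ne_zero h
  have hmem : m + n₁ ∈ connIn (cutGraph G δ.used) x u := by
    by_contra hc
    exact hne (Set.indicator_of_notMem hc _)
  rw [mem_connIn_iff] at hmem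
  -- `x ↔ u` in the trace of `n₁ + n₂`
  have hle : m + n₁ ≤ n₁ + n₂ := fun e => by
    simp only [Pi.add_apply]
    calc m e + n₁ e ≤ n₂ e + n₁ e := Nat.add_le_add_right (hm e) _
      _ = n₁ e + n₂ e := Nat.add_comm _ _
  have hsub : (m + n₁).tracedIn (cutGraph G δ.used) ⊆ (n₁ + n₂).traced :=
    (tracedIn_subset_traced (cutGraph G δ.used) (m + n₁)).trans (traced_mono hle)
  have hxu : (openGraph (n₁ + n₂).traced).Reachable x u := hmem.mono (openGraph_mono hsub)
  -- `z ↔ u` in the trace of `n₂`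
  have hu' : u ∈ n₂.cluster z := by
    rw [← hδ] at hu
    exact tch_explore_subset_cluster z (vis_subset_tch_explore z hu)
  have hzu : (openGraph (n₁ + n₂).traced).Reachable z u :=
    (mem_cluster_iff.1 hu').mono (openGraph_mono (traced_mono (le_add_self : n₂ ≤ n₁ + n₂)))
  rw [mem_tracedConn_iff]
  exact hxu.trans hzu.symm

/-! ### The connection mass as an `ℝ≥0∞` pair sum -/

/-- The real pair weight in `ℝ≥0∞`: `ofReal (pairWeight β A B p) = w_A(p.1) · w_B(p.2)` with
`w_A(n) = 1{∂n = A} eweight_β(n)` (`β ≥ 0`). [folklore] -/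
theorem ofReal_pairWeight {β : ℝ} (hβ : 0 ≤ β) (A B : Finset V) (p : Current G × Current G) :
    ENNReal.ofReal (pairWeight G β A B p) =
      (if p.1.sources = A then p.1.eweight (fun _ => β) else 0) *
        (if p.2.sources = B then p.2.eweight (fun _ => β) else 0) := by
  unfold pairWeight Current.eweight
  by_cases h1 : p.1.sources = A
  · by_cases h2 : p.2.sources = B
    · rw [if_pos ⟨h1, h2⟩, if_pos h1, if_pos h2, ENNReal.ofReal_mul (Current.weight_nonneg hβ p.1)]
      rfl
    · rw [if_neg (fun h => h2 h.2), if_neg h2, mul_zero, ENNReal.ofReal_zero]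
  · rw [if_neg (fun h => h1 h.1), if_neg h1, zero_mul, ENNReal.ofReal_zero]

/-- **The connection mass as a pair sum**:
`connMass G β x y z t = Σ_{(n₁,n₂)} 1{∂n₁={x}Δ{y}} w(n₁) 1{∂n₂={z}Δ{t}} w(n₂) 1[x ↔ z in n₁+n₂]`
(`doubleCurrentMeasure_real_mul'`, valid without non-degeneracy). [cite: AizenmanDuminilCopinAnnals2021, §3 (3.11)] -/
theorem connMass_eq_tsum {β : ℝ} (hβ : 0 ≤ β) (x y z t : V) :
    connMass G β x y z t = ∑' p : Current G × Current G,
      (if p.1.sources = {x} ∆ {y} then p.1.eweight (fun _ => β) else 0) *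
        (if p.2.sources = {z} ∆ {t} then p.2.eweight (fun _ => β) else 0) *
        (tracedConn G x z).indicator 1 p := by
  classical
  unfold connMass
  rw [doubleCurrentMeasure_real_mul' G hβ _ _ (measurableSet_tracedConn G x z)]
  have h1 : ∀ p : Current G × Current G,
      ‖(tracedConn G x z).indicator (1 : Current G × Current G → ℝ) p‖ ≤ 1 := fun p => by
    rw [Set.indicator_apply]; split_ifs <;> simp
  have hnn : ∀ p : Current G × Current G,
      0 ≤ pairWeight G β ({x} ∆ {y}) ({z} ∆ {t}) p * (tracedConn G x z).indicator 1 p := fun p =>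
    mul_nonneg (pairWeight_nonneg G hβ _ _ p) (by rw [Set.indicator_apply]; split_ifs <;> simp)
  rw [ENNReal.ofReal_tsum_of_nonneg hnn (summable_pairWeight_mul G β _ _ h1)]
  refine tsum_congr fun p => ?_
  rw [ENNReal.ofReal_mul (pairWeight_nonneg G hβ _ _ p), ofReal_pairWeight hβ]
  congr 1
  by_cases hp : p ∈ tracedConn G x z
  · rw [Set.indicator_of_mem hp, Set.indicator_of_mem hp, Pi.one_apply, Pi.one_apply,
      ENNReal.ofReal_one]
  · rw [Set.indicator_of_notMem hp, Set.indicator_of_notMem hp, ENNReal.ofReal_zero]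

/-! ### The decomposition, one backbone state at a time -/

/-- `n|_D ≤ n`. [folklore] -/
theorem onEdges_le (D : Finset G.edgeFinset) (n : Current G) : onEdges D n ≤ n := fun e => by
  unfold onEdges; split_ifs <;> simp

/-- **One backbone state**: for `δ ∈ finalStates rk {t} z t`,
`patSum(δ) · Σ W_δ 1[N_δ ≥ 1] ≤ Σ_{n₁} Σ_{n₂ ∈ Cyl(δ)} w(n₁) w(n₂) 1[x ↔ z in n₁+n₂]`
(functional chain rule + contact inclusion). [cite: AizenmanCMP1982, Prop. 9.2] -/
theorem patSum_mul_cutContactMass_le {β : ℝ} (hβ : 0 ≤ β) {rk : G.edgeFinset → ℕ}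
    (hrk : Function.Injective rk) (x y z t : V) {δ : XState G} (hδ : δ ∈ finalStates rk {t} z t) :
    patSum (fun _ => β) δ * cutContactMass (fun _ => β) δ.used δ.vis x y ≤
      ∑' n₁ : Current G, ∑' n₂ : Current G,
        (if n₁.sources = {x} ∆ {y} then n₁.eweight (fun _ => β) else 0) *
          ((if n₂.sources = {z} ∆ {t} then n₂.eweight (fun _ => β) else 0) *
            (if InCyl δ n₂ then 1 else 0)) *
          (tracedConn G x z).indicator 1 (n₁, n₂) := by
  set K : G.edgeFinset → ℝ := fun _ => β with hKdef
  have hK : ∀ e, 0 ≤ K e := fun _ => hβ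
  obtain ⟨-, n₀, hδ'⟩ := mem_finalStates_iff.1 hδ
  have h0 : ({z} ∆ {t}) ∆ ({z} ∆ {t}) = (∅ : Finset V) := by rw [symmDiff_self]; rfl
  -- the left side, rewritten as an iterated sum `Σ_{n₁} w_A(n₁) · patSum · Σ_m w_S(m) J(m + n₁)`
  have hL : patSum K δ * cutContactMass K δ.used δ.vis x y =
      ∑' n₁ : Current G, (if n₁.sources = {x} ∆ {y} then n₁.eweight K else 0) *
        (patSum K δ * ∑' m : Current G,
          (if IsSupp (cutGraph G δ.used) m ∧ m.sources = ({z} ∆ {t}) ∆ ({z} ∆ {t})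
            then m.eweight K else 0) *
            (if contactCount G δ.used δ.vis x (m + n₁) = 0 then 0 else 1)) := by
    rw [h0]
    unfold cutContactMass cutPairWeight
    rw [ENNReal.tsum_prod', ENNReal.tsum_comm, ← ENNReal.tsum_mul_left]
    refine tsum_congr fun n₁ => ?_
    rw [← ENNReal.tsum_mul_left, ← ENNReal.tsum_mul_left, ← ENNReal.tsum_mul_left]
    refine tsum_congr fun m => ?_
    ring
  rw [hL]
  refine ENNReal.tsum_le_tsum fun n₁ => ?_
  -- the functional chain rule with `H m = J(m + n₁)`
  rw [← tsum_sources_inCyl_mul_eq_of_mem_finalStates hK hrk hδ ({z} ∆ {t})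
    (fun m => if contactCount G δ.used δ.vis x (m + n₁) = 0 then (0 : ℝ≥0∞) else 1),
    ← ENNReal.tsum_mul_left]
  refine ENNReal.tsum_le_tsum fun n₂ => ?_
  -- termwise: the contact inclusion
  by_cases hB : n₂.sources = {z} ∆ {t} ∧ InCyl δ n₂
  · rw [if_pos hB, if_pos hB.1, if_pos hB.2, mul_one]
    by_cases hJ : contactCount G δ.used δ.vis x (onEdges δ.usedᶜ n₂ + n₁) = 0
    · rw [if_pos hJ]; simp
    · rw [if_neg hJ]
      have hex : explore rk n₂ {t} z = δ := by
        rw [hδ']; exact (explore_eq_iff_inCyl hrk).2 (hδ' ▸ hB.2)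
      have hmem : (n₁, n₂) ∈ tracedConn G x z :=
        mem_tracedConn_of_contactCount_ne_zero hex (onEdges_le _ n₂) hJ
      rw [Set.indicator_of_mem hmem, Pi.one_apply, mul_one, mul_one]
  · rw [if_neg hB, zero_mul, mul_zero]
    exact bot_le

/-! ### Partition of the connection mass by the final state of the partner's walk -/

/-- **The connection mass partitioned by the backbone state**: with
`g(n₁,n₂) = 1{∂n₁={x}Δ{y}} w(n₁) 1{∂n₂={z}Δ{t}} w(n₂) 1[x ↔ z in n₁+n₂]`,
`connMass = Σ_{δ ∈ finalStates(z→t)} Σ_{n₁} Σ_{n₂ ∈ Cyl(δ)} g(n₁,n₂)` — the walk of a `{z,t}`-sourced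
current ends at `t` (`Current.explore_done_of_sources_eq`) and the currents are partitioned by their
final state (`Current.tsum_mul_indicator_pos_eq_sum`). [cite: AizenmanCMP1982, Prop. 9.2] -/
theorem connMass_eq_sum_finalStates {β : ℝ} (hβ : 0 ≤ β) {rk : G.edgeFinset → ℕ}
    (hrk : Function.Injective rk) (x y z t : V) :
    connMass G β x y z t =
      ∑ δ ∈ finalStates rk {t} z t, ∑' n₁ : Current G, ∑' n₂ : Current G,
        (if n₁.sources = {x} ∆ {y} then n₁.eweight (fun _ => β) else 0) *
          ((if n₂.sources = {z} ∆ {t} then n₂.eweight (fun _ => β) else 0) *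
            (if InCyl δ n₂ then 1 else 0)) *
          (tracedConn G x z).indicator 1 (n₁, n₂) := by
  set K : G.edgeFinset → ℝ := fun _ => β with hKdef
  set g : Current G → Current G → ℝ≥0∞ := fun n₁ n₂ =>
    (if n₁.sources = {x} ∆ {y} then n₁.eweight K else 0) *
      (if n₂.sources = {z} ∆ {t} then n₂.eweight K else 0) *
      (tracedConn G x z).indicator 1 (n₁, n₂) with hg
  have hR : connMass G β x y z t =
      ∑ δ ∈ finalStates rk {t} z t, ∑' n₁ : Current G, ∑' n₂ : Current G,
        g n₁ n₂ * (if InCyl δ n₂ then 1 else 0) := by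
    rw [connMass_eq_tsum hβ, ENNReal.tsum_prod', ← Summable.tsum_finsetSum (fun _ _ => ENNReal.summable)]
    refine tsum_congr fun n₁ => ?_
    rw [← tsum_mul_indicator_pos_eq_sum (Y := {t}) hrk (g n₁) z t]
    refine tsum_congr fun n₂ => ?_
    by_cases hs : n₂.sources = {z} ∆ {t}
    · rw [if_pos (explore_done_of_sources_eq hrk hs).2, mul_one]
    · simp [hg, hs]
  rw [hR]
  refine Finset.sum_congr rfl fun δ _ => tsum_congr fun n₁ => tsum_congr fun n₂ => ?_
  simp only [hg]
  ring

/-! ### The registered stub -/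

/-- **Stub 1 of the line `partner-backbone-cut` — backbone-cut decomposition + contact inclusion**:
for every finite graph, uniform coupling `β ≥ 0`, injective ranking and vertices `x y z t`,
`Σ_{δ ∈ finalStates(z→t)} patSum(δ) · (Σ W_δ 1[N_δ ≥ 1]) ≤ P^{xy,zt}[x ↔ z] · Z[xy] · Z[zt]`:
conditioning Aizenman's identity on the explored backbone of the partner's current, the remainder is
an exact sourceless current on the cut graph and every contact of the cluster of `x` (inside the cut
graph) with the backbone forces `x ↔ z`. (Aizenman 1982 §9, Prop. 9.2; Aizenman–Duminil-Copin 2021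
§3 (3.11).) [cite: AizenmanCMP1982, §9 Prop. 9.2] -/
theorem stub_backboneCutDecomposition :
    ∀ (V : Type) [Fintype V] [DecidableEq V] (G : SimpleGraph V) [DecidableRel G.Adj]
      (β : ℝ), 0 ≤ β → ∀ (rk : G.edgeFinset → ℕ), Function.Injective rk → ∀ (x y z t : V),
        ∑ δ ∈ Current.finalStates rk {t} z t,
            patSum (fun _ => β) δ * cutContactMass (fun _ => β) δ.used δ.vis x y
          ≤ connMass G β x y z t := by
  intro V _ _ G _ β hβ rk hrk x y z t
  rw [connMass_eq_sum_finalStates hβ hrk x y z t]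
  exact Finset.sum_le_sum fun δ hδ => patSum_mul_cutContactMass_le hβ hrk x y z t hδ

end Summit.CriticalPhenomena.Ising3DConformalLimit.Cruxes.IsingEuclidUpgradeR4NonGaussian.PartnerBackboneCut
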